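import Mathlib.Analysis.Fourier.Convolution
import Mathlib.Analysis.Fourier.Inversion
import Summits.NavierStokesRegularity.NavierStokesRegularity.Theorems.TautLoopKelvinCirculationFloorKernelLaplacian
import Literature.Analysis.FunctionSpaces.LittlewoodPaleyKernel
import Literature.Analysis.FunctionSpaces.LittlewoodPaleyMultiplierProofs
import HarnessLib

/-!
# Factorisation of band-limited Schwartz kernels through a ball indicator (stub `stub_kernelFactorisation`)

Helper file of the line lead of crux `stmt-NavierStokesRegularity-1538` (`TautLoopKelvin.CirculationFloor`,
line `birth`), second half of the registered stub `stub_kernelFactorisation`.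

If `N ∈ 𝓢(ℝ³, ℂ)` is supported in the ball `‖ξ‖ ≤ 2` and `χ` is the indicator of the ball `B(0, θ)`,
`θ = 1/32`, then `𝓕⁻ N = χ ⋆ M` for a Schwartz function `M`: indeed `Re 𝓕χ(ξ) ≥ cos(π/4)·|B(0,θ)| > 0`
for `‖ξ‖ ≤ 4` (on the ball, `|2π⟪v,ξ⟫| ≤ π/4`), so with the low-frequency bump `b = χ_LP(·/2)`
(`= 1` on `‖ξ‖ ≤ 2`, `= 0` on `‖ξ‖ ≥ 4`) the smooth function `D = b·𝓕χ + (1 - b)` never vanishes and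
equals `𝓕χ` on the support of `N`; `M := 𝓕⁻(N/D)` is Schwartz (smooth, compact support) and
`𝓕(χ ⋆ M) = 𝓕χ · N/D = N = 𝓕(𝓕⁻N)`, whence `χ ⋆ M = 𝓕⁻ N` by Fourier inversion of continuous integrable
functions (Mathlib `Real.fourier_smul_convolution_eq`, `Continuous.fourierInv_fourier_eq`). Applied to the
symbols `Nₖ = 2πiξₖ σ_L` of `∂ₖ L` (`stub_kernelLaplacianTools`) this gives `∂ₖ L(x) = ∫_{B(x,θ)} Mₖ` with
`Mₖ = Re 𝓕⁻(Nₖ/D)`, the second clause of `stub_kernelFactorisation`. No definitions are introduced.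

## References

* H. Bahouri, J.-Y. Chemin, R. Danchin, *Fourier Analysis and Nonlinear PDE* (2011), Lemma 2.1–2.2.
  [BahouriCheminDanchin2011]
-/

noncomputable section

open MeasureTheory SchwartzMap Real Complex FourierTransform Set Metric
open scoped FourierTransform RealInnerProductSpace LineDeriv ContDiff Convolution

-- the summit and its single sub-problem share the name (CONVENTIONS §1), as in every Theorems file
set_option linter.dupNamespace false

namespace Summit.NavierStokesRegularity.NavierStokesRegularity.Theorems.CirculationFloor.Birth

open Literature.Analysis.FunctionSpaces

/-! ### The indicator of the small ball and its Fourier transform -/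

/-- The indicator `χ` of the ball `B(0, 1/32)` (complex-valued) is integrable. [folklore] -/
theorem kernel_integrable_ballIndicator :
    Integrable ((ball (0 : EuclideanSpace ℝ (Fin 3)) (1 / 32)).indicator fun _ => (1 : ℂ)) := by
  rw [integrable_indicator_iff measurableSet_ball]
  exact integrableOn_const (measure_ball_lt_top.ne)

/-- The moments `‖v‖ⁿ χ(v)` of the ball indicator are integrable (bounded, compact support). [folklore] -/
theorem kernel_integrable_pow_mul_ballIndicator (n : ℕ) :
    Integrable (fun v : EuclideanSpace ℝ (Fin 3) =>
      ‖v‖ ^ n * ‖(ball (0 : EuclideanSpace ℝ (Fin 3)) (1 / 32)).indicator (fun _ => (1 : ℂ)) v‖) := by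
  have h : (fun v : EuclideanSpace ℝ (Fin 3) =>
      ‖v‖ ^ n * ‖(ball (0 : EuclideanSpace ℝ (Fin 3)) (1 / 32)).indicator (fun _ => (1 : ℂ)) v‖) =
      (ball (0 : EuclideanSpace ℝ (Fin 3)) (1 / 32)).indicator fun v => ‖v‖ ^ n := by
    funext v
    by_cases hv : v ∈ ball (0 : EuclideanSpace ℝ (Fin 3)) (1 / 32)
    · rw [Set.indicator_of_mem hv, Set.indicator_of_mem hv, norm_one, mul_one]
    · rw [Set.indicator_of_notMem hv, Set.indicator_of_notMem hv, norm_zero, mul_zero]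
  rw [h, integrable_indicator_iff measurableSet_ball]
  exact ((continuous_norm.pow n).continuousOn.integrableOn_compact
    (isCompact_closedBall (0 : EuclideanSpace ℝ (Fin 3)) (1 / 32))).mono_set ball_subset_closedBall

/-- The Fourier transform of the ball indicator is smooth. [folklore] -/
theorem kernel_contDiff_fourier_ballIndicator :
    ContDiff ℝ ∞ (𝓕 ((ball (0 : EuclideanSpace ℝ (Fin 3)) (1 / 32)).indicator fun _ => (1 : ℂ))) :=
  contDiff_fourier fun n _ => kernel_integrable_pow_mul_ballIndicator n

/-- **Positivity of `Re 𝓕χ` on the ball `‖ξ‖ ≤ 4`**: `Re 𝓕χ(ξ) ≥ (√2/2) |B(0,1/32)|`, because on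
`B(0, 1/32)` the phase satisfies `|2π⟪v,ξ⟩| ≤ π/4`, so `cos(2π⟪v,ξ⟫) ≥ cos(π/4)`. [folklore] -/
theorem kernel_re_fourier_ballIndicator_ge {ξ : EuclideanSpace ℝ (Fin 3)} (hξ : ‖ξ‖ ≤ 4) :
    √2 / 2 * (volume (ball (0 : EuclideanSpace ℝ (Fin 3)) (1 / 32))).toReal ≤
      (𝓕 ((ball (0 : EuclideanSpace ℝ (Fin 3)) (1 / 32)).indicator (fun _ => (1 : ℂ))) ξ).re := by
  set s : Set (EuclideanSpace ℝ (Fin 3)) := ball 0 (1 / 32) with hs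
  have hsm : MeasurableSet s := measurableSet_ball
  have hsfin : volume s < ⊤ := measure_ball_lt_top
  -- the Fourier integral as a set integral of the phase over the ball
  have h1 : 𝓕 (s.indicator fun _ => (1 : ℂ)) ξ =
      ∫ v in s, Complex.exp ((↑(-2 * π * ⟪v, ξ⟫)) * Complex.I) := by
    rw [Real.fourier_eq', ← integral_indicator hsm]
    refine integral_congr_ae (Filter.Eventually.of_forall fun v => ?_)
    by_cases hv : v ∈ s
    · simp [hv]
    · simp [hv]
  have hcont : Continuous fun v : EuclideanSpace ℝ (Fin 3) =>
      Complex.exp ((↑(-2 * π * ⟪v, ξ⟫)) * Complex.I) := by fun_prop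
  have hint : IntegrableOn (fun v : EuclideanSpace ℝ (Fin 3) =>
      Complex.exp ((↑(-2 * π * ⟪v, ξ⟫)) * Complex.I)) s volume :=
    (hcont.continuousOn.integrableOn_compact (isCompact_closedBall 0 (1 / 32))).mono_set
      ball_subset_closedBall
  have h2 := integral_re hint
  simp only [RCLike.re_to_complex] at h2
  rw [h1, ← h2]
  have hcos : ∀ v, (Complex.exp ((↑(-2 * π * ⟪v, ξ⟫)) * Complex.I)).re = Real.cos (2 * π * ⟪v, ξ⟫) := by
    intro v
    rw [Complex.exp_ofReal_mul_I_re, show (-2 * π * ⟪v, ξ⟫ : ℝ) = -(2 * π * ⟪v, ξ⟫) by ring,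
      Real.cos_neg]
  simp_rw [hcos]
  -- pointwise lower bound on the ball
  have hle : ∀ v ∈ s, √2 / 2 ≤ Real.cos (2 * π * ⟪v, ξ⟫) := by
    intro v hv
    rw [hs, mem_ball_zero_iff] at hv
    have hphase : |2 * π * ⟪v, ξ⟫| ≤ π / 4 := by
      rw [abs_mul, abs_of_pos (by positivity : (0 : ℝ) < 2 * π)]
      calc 2 * π * |⟪v, ξ⟫| ≤ 2 * π * (‖v‖ * ‖ξ‖) :=
            mul_le_mul_of_nonneg_left (abs_real_inner_le_norm v ξ) (by positivity)
        _ ≤ 2 * π * (1 / 32 * 4) := by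
            gcongr
        _ = π / 4 := by ring
    rw [← Real.cos_pi_div_four, ← Real.cos_abs (2 * π * ⟪v, ξ⟫)]
    exact Real.cos_le_cos_of_nonneg_of_le_pi (abs_nonneg _) (by linarith [Real.pi_pos]) hphase
  have hconst : ∫ _ in s, (√2 / 2 : ℝ) = √2 / 2 * (volume s).toReal := by
    rw [setIntegral_const, smul_eq_mul, mul_comm]
    rfl
  rw [← hconst]
  refine setIntegral_mono_on (integrableOn_const hsfin.ne) ?_ hsm hle
  exact ((Real.continuous_cos.comp (by fun_prop)).continuousOn.integrableOn_compact
    (isCompact_closedBall 0 (1 / 32))).mono_set ball_subset_closedBall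

/-- The ball `B(0, 1/32) ⊂ ℝ³` has positive finite volume. [folklore] -/
theorem kernel_volume_ball_toReal_pos :
    0 < (volume (ball (0 : EuclideanSpace ℝ (Fin 3)) (1 / 32))).toReal :=
  ENNReal.toReal_pos (measure_ball_pos volume 0 (by norm_num)).ne' measure_ball_lt_top.ne

/-! ### The factorisation through `χ` -/

/-- The low-frequency bump `b = χ_LP(·/2)` is `1` on `‖ξ‖ ≤ 2`. [folklore] -/
theorem kernel_lowFreqSymbol_one_eq_one {ξ : EuclideanSpace ℝ (Fin 3)} (h : ‖ξ‖ ≤ 2) :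
    lowFreqSymbol 1 ξ = 1 := by
  rw [lowFreqSymbol, dyadicCutoff_apply_of_norm_le_one]
  · simp
  · rw [norm_smul, zpow_neg, zpow_one, Real.norm_eq_abs, abs_of_pos (by norm_num : (0 : ℝ) < 2⁻¹)]
    linarith

/-- The low-frequency bump `b = χ_LP(·/2)` vanishes on `4 ≤ ‖ξ‖`. [folklore] -/
theorem kernel_lowFreqSymbol_one_eq_zero {ξ : EuclideanSpace ℝ (Fin 3)} (h : 4 ≤ ‖ξ‖) :
    lowFreqSymbol 1 ξ = 0 := by
  rw [lowFreqSymbol, dyadicCutoff_apply_of_two_le_norm]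
  · simp
  · rw [norm_smul, zpow_neg, zpow_one, Real.norm_eq_abs, abs_of_pos (by norm_num : (0 : ℝ) < 2⁻¹)]
    linarith

/-- The low-frequency bump is real with values in `[0, 1]`. [folklore] -/
theorem kernel_lowFreqSymbol_one_mem (ξ : EuclideanSpace ℝ (Fin 3)) :
    ∃ b : ℝ, 0 ≤ b ∧ b ≤ 1 ∧ lowFreqSymbol 1 ξ = (b : ℂ) :=
  ⟨_, (dyadicCutoff (EuclideanSpace ℝ (Fin 3))).nonneg, (dyadicCutoff (EuclideanSpace ℝ (Fin 3))).le_one, rfl⟩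

/-- **Symbol division through `𝓕χ`.** Let `χ : ℝ³ → ℂ` be integrable with `𝓕χ` smooth and
`Re 𝓕χ ≥ c > 0` on `‖ξ‖ ≤ 4`. Then every Schwartz symbol `N` vanishing on `2 ≤ ‖ξ‖` is `N = 𝓕χ · τ`
for a Schwartz symbol `τ` (`τ = N/D`, `D = b 𝓕χ + (1 - b)` with the low-frequency bump `b`). [folklore] -/
theorem kernel_exists_symbol_div {χ : EuclideanSpace ℝ (Fin 3) → ℂ} (hF : ContDiff ℝ ∞ (𝓕 χ))
    {c : ℝ} (hc : 0 < c) (hpos : ∀ ξ, ‖ξ‖ ≤ 4 → c ≤ (𝓕 χ ξ).re)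
    (N : 𝓢(EuclideanSpace ℝ (Fin 3), ℂ)) (hN : ∀ ξ, 2 ≤ ‖ξ‖ → N ξ = 0) :
    ∃ τ : 𝓢(EuclideanSpace ℝ (Fin 3), ℂ), ∀ ξ, 𝓕 χ ξ * τ ξ = N ξ := by
  set D : EuclideanSpace ℝ (Fin 3) → ℂ := fun ξ => lowFreqSymbol 1 ξ * 𝓕 χ ξ + (1 - lowFreqSymbol 1 ξ)
    with hD
  have hDsmooth : ContDiff ℝ ∞ D :=
    ((contDiff_lowFreqSymbol 1).mul hF).add (contDiff_const.sub (contDiff_lowFreqSymbol 1))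
  -- `Re D ≥ min c 1 > 0`
  have hDre : ∀ ξ, min c 1 ≤ (D ξ).re := by
    intro ξ
    obtain ⟨b, hb0, hb1, hb⟩ := kernel_lowFreqSymbol_one_mem ξ
    have hre : (D ξ).re = b * (𝓕 χ ξ).re + (1 - b) := by
      simp [hD, hb, Complex.mul_re]
    rw [hre]
    by_cases hξ : ‖ξ‖ ≤ 4
    · have h1 := hpos ξ hξ
      calc min c 1 = b * min c 1 + (1 - b) * min c 1 := by ring
        _ ≤ b * (𝓕 χ ξ).re + (1 - b) * 1 :=
            add_le_add (mul_le_mul_of_nonneg_left ((min_le_left _ _).trans h1) hb0)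
              (mul_le_mul_of_nonneg_left (min_le_right _ _) (by linarith))
        _ = b * (𝓕 χ ξ).re + (1 - b) := by ring
    · have hb00 : lowFreqSymbol 1 ξ = 0 := kernel_lowFreqSymbol_one_eq_zero (not_le.1 hξ).le
      have hbz : b = 0 := by exact_mod_cast hb.symm.trans hb00
      rw [hbz]
      simp
  have hDne : ∀ ξ, D ξ ≠ 0 := by
    intro ξ h0
    have := hDre ξ
    rw [h0, Complex.zero_re] at this
    exact absurd this (not_le.2 (lt_min hc one_pos))
  -- `τ = N / D`
  set τ : EuclideanSpace ℝ (Fin 3) → ℂ := fun ξ => N ξ * (D ξ)⁻¹ with hτ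
  have hτsmooth : ContDiff ℝ ∞ τ := (N.smooth ⊤).mul (hDsmooth.inv hDne)
  have hNsupp : HasCompactSupport (⇑N) :=
    HasCompactSupport.intro (isCompact_closedBall (0 : EuclideanSpace ℝ (Fin 3)) 2) fun ξ hξ =>
      hN ξ (by rw [mem_closedBall_zero_iff, not_le] at hξ; exact hξ.le)
  have hτsupp : HasCompactSupport τ := hNsupp.mul_right
  refine ⟨hτsupp.toSchwartzMap hτsmooth, fun ξ => ?_⟩
  rw [HasCompactSupport.toSchwartzMap_toFun]
  by_cases hξ : 2 ≤ ‖ξ‖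
  · simp [hτ, hN ξ hξ]
  · have hb1 : lowFreqSymbol 1 ξ = 1 := kernel_lowFreqSymbol_one_eq_one (not_le.1 hξ).le
    have hDξ : D ξ = 𝓕 χ ξ := by simp [hD, hb1]
    rw [hτ]
    simp only
    rw [← hDξ, mul_comm, mul_assoc, inv_mul_cancel₀ (hDne ξ), mul_one]

/-- **Factorisation of band-limited Schwartz kernels through `χ`.** With `χ` as in
`kernel_exists_symbol_div`, for every Schwartz symbol `N` vanishing on `2 ≤ ‖ξ‖` there is a Schwartz
function `M` with `𝓕⁻ N = χ ⋆ M` pointwise (Fourier inversion of continuous integrable functions: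
`𝓕(χ ⋆ M) = 𝓕χ · 𝓕M = N = 𝓕(𝓕⁻N)`). [folklore] -/
theorem kernel_exists_factor {χ : EuclideanSpace ℝ (Fin 3) → ℂ} (hχ : Integrable χ)
    (hF : ContDiff ℝ ∞ (𝓕 χ)) {c : ℝ} (hc : 0 < c) (hpos : ∀ ξ, ‖ξ‖ ≤ 4 → c ≤ (𝓕 χ ξ).re)
    (N : 𝓢(EuclideanSpace ℝ (Fin 3), ℂ)) (hN : ∀ ξ, 2 ≤ ‖ξ‖ → N ξ = 0) :
    ∃ M : 𝓢(EuclideanSpace ℝ (Fin 3), ℂ), ∀ x,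
      (𝓕⁻ N : 𝓢(EuclideanSpace ℝ (Fin 3), ℂ)) x = (χ ⋆[ContinuousLinearMap.lsmul ℂ ℂ, volume] (⇑M)) x := by
  obtain ⟨τ, hτ⟩ := kernel_exists_symbol_div hF hc hpos N hN
  refine ⟨𝓕⁻ τ, fun x => ?_⟩
  set M : 𝓢(EuclideanSpace ℝ (Fin 3), ℂ) := 𝓕⁻ τ with hM
  set h : EuclideanSpace ℝ (Fin 3) → ℂ := χ ⋆[ContinuousLinearMap.lsmul ℂ ℂ, volume] (⇑M) with hh
  -- `h` is continuous and integrable, with Fourier transform `N`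
  have hMbdd : BddAbove (range fun x => ‖M x‖) := by
    obtain ⟨C, -, hC⟩ := M.decay 0 0
    refine ⟨C, ?_⟩
    rintro _ ⟨y, rfl⟩
    simpa using hC y
  have hhcont : Continuous h := hMbdd.continuous_convolution_right_of_integrable _ hχ M.continuous
  have hhint : Integrable h := hχ.integrable_convolution _ M.integrable
  have hFh : 𝓕 h = ⇑N := by
    funext ξ
    rw [hh, Real.fourier_smul_convolution_eq hχ M.integrable ξ, smul_eq_mul, hM, ← fourier_coe,
      fourier_fourierInv_eq]
    exact hτ ξ
  have hFN : 𝓕 (⇑(𝓕⁻ N : 𝓢(EuclideanSpace ℝ (Fin 3), ℂ))) = ⇑N := by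
    rw [← fourier_coe, fourier_fourierInv_eq]
  -- Fourier inversion on both sides
  have h1 : (⇑(𝓕⁻ N : 𝓢(EuclideanSpace ℝ (Fin 3), ℂ))) = 𝓕⁻ (⇑N : EuclideanSpace ℝ (Fin 3) → ℂ) := by
    have := (𝓕⁻ N : 𝓢(EuclideanSpace ℝ (Fin 3), ℂ)).continuous.fourierInv_fourier_eq
      (𝓕⁻ N : 𝓢(EuclideanSpace ℝ (Fin 3), ℂ)).integrable (by rw [hFN]; exact N.integrable)
    rw [hFN] at this
    exact this.symm
  have h2 : h = 𝓕⁻ (⇑N : EuclideanSpace ℝ (Fin 3) → ℂ) := by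
    have := hhcont.fourierInv_fourier_eq hhint (by rw [hFh]; exact N.integrable)
    rw [hFh] at this
    exact this.symm
  rw [h2, ← h1]

/-- **`𝓕⁻ N (x) = ∫_{B(x, 1/32)} M`** for band-limited `N` (supported in `‖ξ‖ ≤ 2`), with `M` Schwartz:
the factorisation through the indicator of `B(0, 1/32)` written as a ball average. [folklore] -/
theorem kernel_exists_ballIntegral (N : 𝓢(EuclideanSpace ℝ (Fin 3), ℂ)) (hN : ∀ ξ, 2 ≤ ‖ξ‖ → N ξ = 0) :
    ∃ M : 𝓢(EuclideanSpace ℝ (Fin 3), ℂ), ∀ x,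
      (𝓕⁻ N : 𝓢(EuclideanSpace ℝ (Fin 3), ℂ)) x = ∫ y in ball x (1 / 32), M y := by
  have hc : 0 < √2 / 2 * (volume (ball (0 : EuclideanSpace ℝ (Fin 3)) (1 / 32))).toReal :=
    mul_pos (by positivity) kernel_volume_ball_toReal_pos
  obtain ⟨M, hM⟩ := kernel_exists_factor kernel_integrable_ballIndicator
    kernel_contDiff_fourier_ballIndicator hc (fun ξ hξ => kernel_re_fourier_ballIndicator_ge hξ) N hN
  refine ⟨M, fun x => ?_⟩
  rw [hM x, convolution_lsmul, ← integral_indicator measurableSet_ball,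
    ← integral_sub_left_eq_self (fun y => (ball x (1 / 32)).indicator (⇑M) y) volume x]
  refine integral_congr_ae (Filter.Eventually.of_forall fun t => ?_)
  show (ball (0 : EuclideanSpace ℝ (Fin 3)) (1 / 32)).indicator (fun _ => (1 : ℂ)) t • M (x - t) =
    (ball x (1 / 32)).indicator (⇑M) (x - t)
  by_cases ht : t ∈ ball (0 : EuclideanSpace ℝ (Fin 3)) (1 / 32)
  · have hxt : x - t ∈ ball x (1 / 32) := by
      rw [mem_ball_zero_iff] at ht
      rwa [mem_ball, dist_eq_norm, sub_sub_cancel_left, norm_neg]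
    rw [Set.indicator_of_mem ht, Set.indicator_of_mem hxt, one_smul]
  · have hxt : x - t ∉ ball x (1 / 32) := by
      rw [mem_ball_zero_iff] at ht
      rwa [mem_ball, dist_eq_norm, sub_sub_cancel_left, norm_neg]
    rw [Set.indicator_of_notMem ht, Set.indicator_of_notMem hxt, zero_smul]

/-! ### The registered stub -/

/-- **Registered stub `stub_kernelFactorisation`** (crux `stmt-NavierStokesRegularity-1538`, line `birth`):
with `θ = 1/32` there are a real Schwartz function `L = Re 𝓕⁻σ_L` and three real Schwartz functions
`Mₖ = Re 𝓕⁻(2πiξₖσ_L/D)` on `ℝ³` with `K₀ = -Σₖ ∂ₖ∂ₖ L` (the unit Littlewood–Paley kernel as a Laplacian,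
`stub_kernelLaplacianTools`) and `∂ₖ L(x) = ∫_{B(x,θ)} Mₖ` (factorisation of the band-limited kernel
`∂ₖ L` through the indicator of `B(0,θ)`, `kernel_exists_ballIntegral`). [folklore] -/
theorem stub_kernelFactorisation :
    ∃ θ : ℝ, 0 < θ ∧ θ ≤ 1 ∧
      ∃ (L : SchwartzMap (EuclideanSpace ℝ (Fin 3)) ℝ) (M : Fin 3 → SchwartzMap (EuclideanSpace ℝ (Fin 3)) ℝ),
        (∀ x : EuclideanSpace ℝ (Fin 3),
          Literature.Analysis.FunctionSpaces.blockKernel (EuclideanSpace ℝ (Fin 3)) 0 x =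
            -∑ k : Fin 3, fderiv ℝ (fun y => fderiv ℝ (fun z => L z) y (EuclideanSpace.single k (1 : ℝ))) x
              (EuclideanSpace.single k (1 : ℝ))) ∧
        (∀ (k : Fin 3) (x : EuclideanSpace ℝ (Fin 3)),
          fderiv ℝ (fun z => L z) x (EuclideanSpace.single k (1 : ℝ)) = ∫ y in Metric.ball x θ, M k y) := by
  obtain ⟨S, hSsupp, hK⟩ := stub_kernelLaplacianTools
  -- the symbols `gₖ = 2πiξₖ σ_L` of `∂ₖ 𝓕⁻σ_L`, band-limited like `σ_L`
  choose g hg hgξ using fun k : Fin 3 => kernel_lineDeriv_fourierInv S (EuclideanSpace.single k (1 : ℝ))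
  have hgsupp : ∀ (k : Fin 3) (ξ : EuclideanSpace ℝ (Fin 3)), 2 ≤ ‖ξ‖ → g k ξ = 0 := fun k ξ hξ => by
    rw [hgξ, hSsupp ξ hξ, mul_zero]
  choose MC hMC using fun k : Fin 3 => kernel_exists_ballIntegral (g k) (hgsupp k)
  refine ⟨1 / 32, by norm_num, by norm_num,
    (𝓕⁻ S : 𝓢(EuclideanSpace ℝ (Fin 3), ℂ)).postcompCLM (Complex.reCLM : ℂ →L[ℝ] ℝ),
    fun k => (MC k).postcompCLM (Complex.reCLM : ℂ →L[ℝ] ℝ), fun x => ?_, fun k x => ?_⟩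
  · exact kernel_blockKernel_zero_eq_of_symbol hK x
  · have h1 : fderiv ℝ (fun z => ((𝓕⁻ S : 𝓢(EuclideanSpace ℝ (Fin 3), ℂ)).postcompCLM
        (Complex.reCLM : ℂ →L[ℝ] ℝ)) z) x (EuclideanSpace.single k (1 : ℝ)) =
        (fderiv ℝ (⇑(𝓕⁻ S : 𝓢(EuclideanSpace ℝ (Fin 3), ℂ))) x (EuclideanSpace.single k (1 : ℝ))).re :=
      kernel_fderiv_re_apply _ x _
    rw [h1, ← lineDerivOp_apply_eq_fderiv, hg k, hMC k x]
    have hint : IntegrableOn (⇑(MC k)) (ball x (1 / 32)) volume := (MC k).integrable.integrableOn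
    have h2 := integral_re hint
    simp only [RCLike.re_to_complex] at h2
    rw [← h2]
    rfl

end Summit.NavierStokesRegularity.NavierStokesRegularity.Theorems.CirculationFloor.Birth

end
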